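import Literature.AlgebraicGeometry.AbelianSchemes.AbelianSchemeDualPair
import Literature.AlgebraicGeometry.AbelianVarieties.LineBundleTensorPower
import Literature.AlgebraicGeometry.Modules.DetClassOfIso
import HarnessLib

/-!
# A tuple-isomorphism pulls the canonical bundle `L^Δ(λ₂)` back to `L^Δ(λ₁)` ON THE NOSE (SP3-a2 `stub_ICAN`)

Topic `Literature/AlgebraicGeometry/AbelianSchemes`; namespace `Literature.AlgebraicGeometry.AbelianSchemes.AbelianSchemeOver`.
THEOREMS ONLY (no definition, no named fact, no instance, no notation, no `sorry`).  Cell `hodgecm-mathlib` (D-0151), P6 «MOD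
programme» (crux hLiu418 = stmt-HodgeConjecture-24832), SPREAD door, `inj₀` cofinite passage (LEAD M-26-pre (L1′)), line-candidate
`F0_P6a_IsomSchemeFiniteType` stub **`stub_ICAN`** (A-p14 (g34) census `CENSUS-SP3a2-IsomSchemeFiniteType.v1` finding (F2)).  HC_CM is
proved only modulo the 2 remaining named inputs (hLiu418, h413) until rung 0 closes; this file is generic and changes no count.

## The mathematics

Let `A₁, A₂` be abelian schemes over `S` with dual pairs `(Â₁, 𝒫₁)`, `(Â₂, 𝒫₂)` (★ `DualPair`: `𝒫ᵢ` of rank one on `Aᵢ ×_S Âᵢ`) and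
`S`-morphisms `λᵢ : Aᵢ → Âᵢ`.  Mumford's isomorphism of polarised tuples ([MumfordFogartyKirwan1994] Ch. 7 §2 Def. 7.2; the cell's
`tupleIsoAt` ∕ ★ `PolarizedAbelianSchemeWithLevel.IsBaseChangeVia` along `𝟙 S`) consists of `G : A₁ → A₂`, `Ĝ : Â₁ → Â₂` over `S` with
`(G × Ĝ)^*𝒫₂ ≅ 𝒫₁` and `λ₁ ≫ Ĝ = G ≫ λ₂` (EXACT polarisation).  The CANONICAL BUNDLE of `(Aᵢ, λᵢ)` is
`L^Δ(λᵢ) := (1, λᵢ)^*𝒫ᵢ` ([MumfordFogartyKirwan1994] Ch. 6 §2 Prop. 6.10; the tree's currency `(Scheme.Modules.pullback Grᵢ).obj Dᵢ.P`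
with the graph `Grᵢ : Aᵢ → Aᵢ ×_S Âᵢ` passed as a morphism with its two projections, as in ★ `AbelianSchemeLDeltaOfLambda` and ★
`PolarizedLevelFrameEmbedding`).  Since `(G × Ĝ) ∘ (1, λ₁) = (1, λ₂) ∘ G` (first projection: `G`; second: `λ₁ ≫ Ĝ = G ≫ λ₂`),

  `G^* L^Δ(λ₂) = G^*(1, λ₂)^*𝒫₂ ≅ (1, λ₁)^*(G × Ĝ)^*𝒫₂ ≅ (1, λ₁)^*𝒫₁ = L^Δ(λ₁)`,

an ISOMORPHISM of modules (not merely an algebraic equivalence), and likewise for all tensor powers.  Consequence for the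
`Isom`-scheme of PEL tuples (census (F2)): when `A₁ ×_S A₂` is embedded by the Segre product of the `L^Δ(λᵢ)^{⊗3}`-embeddings,
the graph of every tuple-isomorphism at a point `t` carries `𝒪(1) ≅ L^Δ(λ₁)^{⊗6}|_t` — its Hilbert polynomial is a function of
`t` alone, so the letters of tuple-isomorphisms are bounded by ONE letter per connected component.

* §1 `graph_comp_prodMap_eq_comp_graph` — `(1, λ₁) ≫ (G × Ĝ) = G ≫ (1, λ₂)`.
* §2 **`nonempty_pullback_LDelta_iso_of_tupleIso`** — `G^*L^Δ(λ₂) ≅ L^Δ(λ₁)` (explicit chain of ★ `Scheme.Modules.pullbackComp`,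
  `pullbackCongr` and the Poincaré clause).
* §3 **`nonempty_pullback_LDelta_tensorPow_iso_of_tupleIso`** — `G^*(L^Δ(λ₂)^{⊗n}) ≅ L^Δ(λ₁)^{⊗n}` (rank one: classes in
  `Ȟ¹(A₁, 𝒪^×)`, ★ `nonempty_iso_iff_detClass_eq`, ★ `detClass_pullback`, ★ `detClass_tensorPow`).

## References
* [MumfordFogartyKirwan1994] D. Mumford, J. Fogarty, F. Kirwan, *Geometric Invariant Theory*, 3rd ed. (1994), Ch. 6 §2 Prop. 6.10
  (p. 121); Ch. 7 §2 Definition 7.2 (p. 129) and Prop. 7.3 (p. 132).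
* [StacksProject] The Stacks Project, Tag 01C8 (Modules, Lemma 17.14.3: functoriality of pull-back).
* [Hartshorne1977] R. Hartshorne, *Algebraic Geometry* (1977), II Ex. 6.8, III Ex. 4.5 (`Pic` and `Ȟ¹(𝒪^×)`).
-/

set_option autoImplicit false

noncomputable section

universe u

open CategoryTheory CategoryTheory.Limits AlgebraicGeometry

namespace Literature.AlgebraicGeometry.AbelianSchemes

namespace AbelianSchemeOver

open Literature.AlgebraicGeometry.Motives Literature.AlgebraicGeometry.Modules Literature.AlgebraicGeometry.AbelianVarieties

variable {S : Scheme.{u}} {A₁ A₂ : AbelianSchemeOver S} (D₁ : A₁.DualPair) (D₂ : A₂.DualPair)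
  (lam₁ : A₁.X.left ⟶ D₁.hat.X.left) (lam₂ : A₂.X.left ⟶ D₂.hat.X.left)
  -- the graphs `(1, λᵢ) : Aᵢ → Aᵢ ×_S Âᵢ`, as morphisms with their two projections
  (Gr₁ : A₁.X.left ⟶ A₁.prodLeft D₁.hat) (hGr₁₁ : Gr₁ ≫ pullback.fst A₁.X.hom D₁.hat.X.hom = 𝟙 _)
  (hGr₁₂ : Gr₁ ≫ pullback.snd A₁.X.hom D₁.hat.X.hom = lam₁)
  (Gr₂ : A₂.X.left ⟶ A₂.prodLeft D₂.hat) (hGr₂₁ : Gr₂ ≫ pullback.fst A₂.X.hom D₂.hat.X.hom = 𝟙 _)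
  (hGr₂₂ : Gr₂ ≫ pullback.snd A₂.X.hom D₂.hat.X.hom = lam₂)
  -- the tuple-isomorphism data `(G, Ĝ)` over `𝟙 S` (token shape of the cell's `tupleIsoAt`)
  (G : A₁.X.left ⟶ A₂.X.left) (Ĝ : D₁.hat.X.left ⟶ D₂.hat.X.left)
  (wG : A₁.X.hom ≫ 𝟙 S = G ≫ A₂.X.hom) (wĜ : D₁.hat.X.hom ≫ 𝟙 S = Ĝ ≫ D₂.hat.X.hom)
  (hlam : lam₁ ≫ Ĝ = G ≫ lam₂)

/-! ### §1 The graph of `λ` intertwines `G` and `G × Ĝ` -/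

section Graph

include hGr₁₁ hGr₁₂ hGr₂₁ hGr₂₂ hlam in
/-- **`(1, λ₁) ≫ (G × Ĝ) = G ≫ (1, λ₂)`**: both composites have first projection `G` (`Gr₁ ≫ pr₁ = 𝟙`, `Gr₂ ≫ pr₁ = 𝟙`) and second
projection `λ₁ ≫ Ĝ = G ≫ λ₂` (EXACT polarisation clause). [cite: MumfordFogartyKirwan1994, Ch. 7 §2 Definition 7.2 (p. 129)] -/
theorem graph_comp_prodMap_eq_comp_graph :
    Gr₁ ≫ pullback.map A₁.X.hom D₁.hat.X.hom A₂.X.hom D₂.hat.X.hom G Ĝ (𝟙 S) wG wĜ = G ≫ Gr₂ := by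
  apply pullback.hom_ext
  · rw [Category.assoc, Category.assoc, pullback.lift_fst, reassoc_of% hGr₁₁, hGr₂₁, Category.comp_id]
  · rw [Category.assoc, Category.assoc, pullback.lift_snd, reassoc_of% hGr₁₂, hGr₂₂, hlam]

end Graph

/-! ### §2 `G^*L^Δ(λ₂) ≅ L^Δ(λ₁)` -/

section Pullback

include hGr₁₁ hGr₁₂ hGr₂₁ hGr₂₂ hlam in
/-- **A tuple-isomorphism pulls `L^Δ(λ₂)` back to `L^Δ(λ₁)` on the nose.**  From the Poincaré clause `(G × Ĝ)^*𝒫₂ ≅ 𝒫₁` and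
the exact polarisation clause `λ₁ ≫ Ĝ = G ≫ λ₂`:
`G^*(1,λ₂)^*𝒫₂ ≅ ((1,λ₂) ∘ G)^*𝒫₂ = ((G × Ĝ) ∘ (1,λ₁))^*𝒫₂ ≅ (1,λ₁)^*(G × Ĝ)^*𝒫₂ ≅ (1,λ₁)^*𝒫₁`.
[cite: MumfordFogartyKirwan1994, Ch. 6 §2 Prop. 6.10 (p. 121) and Ch. 7 §2 Definition 7.2 (p. 129)] [cite: StacksProject, Tag 01C8] -/
theorem nonempty_pullback_LDelta_iso_of_tupleIso
    (hP : Nonempty ((Scheme.Modules.pullback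
      (pullback.map A₁.X.hom D₁.hat.X.hom A₂.X.hom D₂.hat.X.hom G Ĝ (𝟙 S) wG wĜ)).obj D₂.P ≅ D₁.P)) :
    Nonempty ((Scheme.Modules.pullback G).obj ((Scheme.Modules.pullback Gr₂).obj D₂.P) ≅
      (Scheme.Modules.pullback Gr₁).obj D₁.P) := by
  obtain ⟨e⟩ := hP
  have hcomm : G ≫ Gr₂ = Gr₁ ≫ pullback.map A₁.X.hom D₁.hat.X.hom A₂.X.hom D₂.hat.X.hom G Ĝ (𝟙 S) wG wĜ :=
    (graph_comp_prodMap_eq_comp_graph D₁ D₂ lam₁ lam₂ Gr₁ hGr₁₁ hGr₁₂ Gr₂ hGr₂₁ hGr₂₂ G Ĝ wG wĜ hlam).symm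
  exact ⟨(Scheme.Modules.pullbackComp G Gr₂).app D₂.P ≪≫ (Scheme.Modules.pullbackCongr hcomm).app D₂.P ≪≫
    ((Scheme.Modules.pullbackComp Gr₁
      (pullback.map A₁.X.hom D₁.hat.X.hom A₂.X.hom D₂.hat.X.hom G Ĝ (𝟙 S) wG wĜ)).app D₂.P).symm ≪≫
    (Scheme.Modules.pullback Gr₁).mapIso e⟩

include hGr₁₁ hGr₁₂ hGr₂₁ hGr₂₂ hlam in
/-- **Tensor powers: `G^*(L^Δ(λ₂)^{⊗n}) ≅ L^Δ(λ₁)^{⊗n}`** — both sides are rank-one (★ `DualPair.hasRank_one`, ★ `hasRank_pullback`,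
★ `hasRank_tensorPow_one`) with equal classes in `Ȟ¹(A₁, 𝒪^×)`: `G^*[L^Δ(λ₂)]ⁿ = [G^*L^Δ(λ₂)]ⁿ = [L^Δ(λ₁)]ⁿ` (§2, ★ `detClass_pullback`,
★ `detClass_tensorPow`, ★ `nonempty_iso_iff_detClass_eq`).  This is the module `𝒪(1)|_{Γ_G}` of the Segre embedding by
`L^Δ(λ₁)^{⊗3} ⊠ L^Δ(λ₂)^{⊗3}` restricted to the graph of `G` (`n = 3`, then `⊗ L^Δ(λ₁)^{⊗3}`).
[cite: MumfordFogartyKirwan1994, Ch. 7 §2 Prop. 7.3 (p. 132)] [cite: Hartshorne1977, II Ex. 6.8 and III Ex. 4.5] -/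
theorem nonempty_pullback_LDelta_tensorPow_iso_of_tupleIso
    (hP : Nonempty ((Scheme.Modules.pullback
      (pullback.map A₁.X.hom D₁.hat.X.hom A₂.X.hom D₂.hat.X.hom G Ĝ (𝟙 S) wG wĜ)).obj D₂.P ≅ D₁.P)) (n : ℕ) :
    Nonempty ((Scheme.Modules.pullback G).obj (tensorPow ((Scheme.Modules.pullback Gr₂).obj D₂.P) n) ≅
      tensorPow ((Scheme.Modules.pullback Gr₁).obj D₁.P) n) := by
  obtain ⟨e⟩ := nonempty_pullback_LDelta_iso_of_tupleIso D₁ D₂ lam₁ lam₂ Gr₁ hGr₁₁ hGr₁₂ Gr₂ hGr₂₁ hGr₂₂ G Ĝ wG wĜ hlam hP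
  -- ranks and local freeness of the two canonical bundles
  have h₁ : HasRank ((Scheme.Modules.pullback Gr₁).obj D₁.P) 1 := hasRank_pullback Gr₁ D₁.hasRank_one
  have h₂ : HasRank ((Scheme.Modules.pullback Gr₂).obj D₂.P) 1 := hasRank_pullback Gr₂ D₂.hasRank_one
  have hL₁ : IsFiniteLocallyFree ((Scheme.Modules.pullback Gr₁).obj D₁.P) := HasRank.isFiniteLocallyFree' h₁
  have hL₂ : IsFiniteLocallyFree ((Scheme.Modules.pullback Gr₂).obj D₂.P) := HasRank.isFiniteLocallyFree' h₂
  -- the class of `G^*L^Δ(λ₂)` is the class of `L^Δ(λ₁)` (§2)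
  have hcl : detClass (hL₂.pullback G) = detClass hL₁ :=
    (nonempty_iso_iff_detClass_eq (hasRank_pullback G h₂) h₁ (hL₂.pullback G) hL₁).mp ⟨e⟩
  rw [nonempty_iso_iff_detClass_eq (hasRank_pullback G (hasRank_tensorPow_one h₂ n)) (hasRank_tensorPow_one h₁ n)
    ((isFiniteLocallyFree_tensorPow hL₂ n).pullback G) (isFiniteLocallyFree_tensorPow hL₁ n),
    detClass_pullback (hE := isFiniteLocallyFree_tensorPow hL₂ n), detClass_tensorPow h₂ hL₂, map_pow,
    ← detClass_pullback (hE := hL₂), hcl, detClass_tensorPow h₁ hL₁]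

end Pullback

end AbelianSchemeOver

end Literature.AlgebraicGeometry.AbelianSchemes

end
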